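import Summits.AnomalousDissipation.AnomalousDissipation.Theorems.SolenoidalFractalHomogenisationLagrangianStepCellLawVOddGainDefectPairing
import HarnessLib

/-!
# K1L `LagrangianRenormalisationStep(Design)` (K1L_D, stmt-AnomalousDissipation-27980; aside 24912), stub `stub_cellLawV0_IS`
# — exact sector NON-expansion of the slot response, part 1: the GREEN PAIRING identities (abstract ODE level)
# (helper; `--supports stmt-AnomalousDissipation-27980`; word-independent)

Summits-side helper file of route `SolenoidalFractalHomogenisation` (prover seat `ad-k1l-cellLawV-w1` g2).  Toward EXACT sector non-expansion of the
slot response `f_T(B) = T∫₀¹a(s)∫₀ˢa(x)e^{−T(s−x)B}dxds` WITHOUT Fourier analysis: the symmetric double integral `∫∫a(s)a(x)·xᵀe^{−T|s−x|B}z` is a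
Green pairing for `C² − ∂²` (`C = TB`), and its energy form is an integral of sector-`τ` forms of `C` and `Cᵀ`.  This file is the abstract ODE level:
for forward solutions `a' = −Ca + φx` (`a(0) = 0`), `c' = −Cc + φz` (`c(0) = 0`) and backward solutions `b' = Cb − φx` (`b(1) = 0`), `d' = Cd − φz`
(`d(1) = 0`), resp. the backward ADJOINT solution `w' = Cᵀw − φx` (`w(1) = 0`):
* `hasDerivAt_dotProduct`, `transpose_mulVec_dotProduct`;
* **`green_swap`** — `∫₀¹φ·(x·c) = ∫₀¹φ·(w·z)` (Fubini on the triangle replaced by the pairing `(w·c)' = φ·(w·z − x·c)`);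
* **`green_energy`** — `∫₀¹[(a+b)·Cᵀ(c+d) + (b−a)·C(d−c)] = −a(1)·c(1) − b(0)·d(0) + 2∫₀¹φ·(x·(c+d))`
  (`Ψ = (b−a)·(c+d)`, `Ψ' = integrand − 2φ·x·(c+d)`; no second derivatives, no inverse of `C`).
The concrete solutions are in `…CellLawVGreenDuhamel`; the sector theorem for `f_T` in a sequel.  Everything PROVED, no definition, no named fact,
no sorry.  Infrastructure for route-1's rung leaf F-D1.A0 (frontier FORMAL rung); NOT a proof of the stub, of the crux, of Onsager's conjecture or of
anomalous dissipation.  Prover seat `ad-k1l-cellLawV-w1` g2, 2026-08-28.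
-/

set_option linter.dupNamespace false

noncomputable section

namespace Summit.AnomalousDissipation.AnomalousDissipation.Theorems.SolenoidalFractalHomogenisation.LagrangianStep.OddGain

open Matrix Finset MeasureTheory Set

/-! ## §11 Abstract Green pairing identities for forward/backward Duhamel solutions -/

section GreenAbstract

/-- `(Cᵀw)·c = w·(Cc)`. [folklore] -/
theorem transpose_mulVec_dotProduct (C : Matrix (Fin 3) (Fin 3) ℝ) (w c : Fin 3 → ℝ) :
    (Cᵀ *ᵥ w) ⬝ᵥ c = w ⬝ᵥ (C *ᵥ c) := by
  rw [Matrix.mulVec_transpose, Matrix.dotProduct_mulVec]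

/-- Derivative of a dot product of two differentiable paths. [folklore] -/
theorem hasDerivAt_dotProduct {f g : ℝ → Fin 3 → ℝ} {f' g' : Fin 3 → ℝ} {s : ℝ} (hf : HasDerivAt f f' s)
    (hg : HasDerivAt g g' s) : HasDerivAt (fun s => f s ⬝ᵥ g s) (f' ⬝ᵥ g s + f s ⬝ᵥ g') s := by
  rw [hasDerivAt_pi] at hf hg
  have h := HasDerivAt.fun_sum (u := Finset.univ) fun i _ => (hf i).mul (hg i)
  show HasDerivAt (fun s => ∑ i, f s i * g s i) _ s
  refine h.congr_deriv ?_
  simp only [dotProduct, ← Finset.sum_add_distrib]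

/-- **THE SWAP IDENTITY** (Fubini on the triangle, by an adjoint pairing): if `c` solves the FORWARD problem `c' = −Cc + φ·z`, `c(0) = 0` and
`w` the BACKWARD ADJOINT problem `w' = Cᵀw − φ·x`, `w(1) = 0` (continuous `φ`), then `∫₀¹ φ·(x·c) = ∫₀¹ φ·(w·z)`
(`(w·c)' = φ·(w·z − x·c)` and `w·c` vanishes at both ends). [folklore] -/
theorem green_swap (C : Matrix (Fin 3) (Fin 3) ℝ) {φ : ℝ → ℝ} (hφ : Continuous φ) (x z : Fin 3 → ℝ) {c w : ℝ → Fin 3 → ℝ}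
    (hc : ∀ s, HasDerivAt c (-(C *ᵥ c s) + φ s • z) s) (hc0 : c 0 = 0)
    (hw : ∀ s, HasDerivAt w (Cᵀ *ᵥ w s - φ s • x) s) (hw1 : w 1 = 0) :
    ∫ s in (0:ℝ)..1, φ s * (x ⬝ᵥ c s) = ∫ s in (0:ℝ)..1, φ s * (w s ⬝ᵥ z) := by
  have hcc : Continuous c := continuous_iff_continuousAt.2 fun s => (hc s).continuousAt
  have hwc : Continuous w := continuous_iff_continuousAt.2 fun s => (hw s).continuousAt
  have hP : ∀ s, HasDerivAt (fun s => w s ⬝ᵥ c s) (φ s * (w s ⬝ᵥ z) - φ s * (x ⬝ᵥ c s)) s := by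
    intro s
    refine (hasDerivAt_dotProduct (hw s) (hc s)).congr_deriv ?_
    rw [sub_dotProduct, dotProduct_add, transpose_mulVec_dotProduct, dotProduct_neg, smul_dotProduct, dotProduct_smul, smul_eq_mul,
      smul_eq_mul]
    ring
  have hi1 : IntervalIntegrable (fun s => φ s * (w s ⬝ᵥ z)) volume 0 1 :=
    (hφ.mul (hwc.dotProduct continuous_const)).intervalIntegrable _ _
  have hi2 : IntervalIntegrable (fun s => φ s * (x ⬝ᵥ c s)) volume 0 1 :=
    (hφ.mul (continuous_const.dotProduct hcc)).intervalIntegrable _ _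
  have hftc := intervalIntegral.integral_eq_sub_of_hasDerivAt (fun s _ => hP s) (hi1.sub hi2)
  rw [intervalIntegral.integral_sub hi1 hi2] at hftc
  simp only [hw1, hc0, zero_dotProduct, dotProduct_zero, sub_zero] at hftc
  linarith

/-- **THE GREEN ENERGY IDENTITY.**  Forward/backward Duhamel solutions `a' = −Ca + φx` (`a(0)=0`), `b' = Cb − φx` (`b(1)=0`), `c' = −Cc + φz`
(`c(0)=0`), `d' = Cd − φz` (`d(1)=0`):
`∫₀¹ [(a+b)·Cᵀ(c+d) + (b−a)·C(d−c)] = −a(1)·c(1) − b(0)·d(0) + 2∫₀¹ φ·(x·(c+d))`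
(`Ψ = (b−a)·(c+d)` has `Ψ' = (a+b)·Cᵀ(c+d) + (b−a)·C(d−c) − 2φ·x·(c+d)`).  With `U = c + d = ∫₀¹e^{−|s−r|C}φ(r)z dr` this is the time-domain
form of `⟨φx, (C² − ∂²)⁻¹…⟩`, with no second derivatives and no inverse of `C`. [folklore] -/
theorem green_energy (C : Matrix (Fin 3) (Fin 3) ℝ) {φ : ℝ → ℝ} (hφ : Continuous φ) (x z : Fin 3 → ℝ) {a b c d : ℝ → Fin 3 → ℝ}
    (ha : ∀ s, HasDerivAt a (-(C *ᵥ a s) + φ s • x) s) (ha0 : a 0 = 0)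
    (hb : ∀ s, HasDerivAt b (C *ᵥ b s - φ s • x) s) (hb1 : b 1 = 0)
    (hc : ∀ s, HasDerivAt c (-(C *ᵥ c s) + φ s • z) s) (hc0 : c 0 = 0)
    (hd : ∀ s, HasDerivAt d (C *ᵥ d s - φ s • z) s) (hd1 : d 1 = 0) :
    ∫ s in (0:ℝ)..1, ((a s + b s) ⬝ᵥ (Cᵀ *ᵥ (c s + d s)) + (b s - a s) ⬝ᵥ (C *ᵥ (d s - c s))) =
      -(a 1 ⬝ᵥ c 1) - (b 0 ⬝ᵥ d 0) + 2 * ∫ s in (0:ℝ)..1, φ s * (x ⬝ᵥ (c s + d s)) := by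
  have hac : Continuous a := continuous_iff_continuousAt.2 fun s => (ha s).continuousAt
  have hbc : Continuous b := continuous_iff_continuousAt.2 fun s => (hb s).continuousAt
  have hcc : Continuous c := continuous_iff_continuousAt.2 fun s => (hc s).continuousAt
  have hdc : Continuous d := continuous_iff_continuousAt.2 fun s => (hd s).continuousAt
  have hΨ : ∀ s, HasDerivAt (fun s => (b s - a s) ⬝ᵥ (c s + d s))
      (((a s + b s) ⬝ᵥ (Cᵀ *ᵥ (c s + d s)) + (b s - a s) ⬝ᵥ (C *ᵥ (d s - c s))) - 2 * (φ s * (x ⬝ᵥ (c s + d s)))) s := by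
    intro s
    have h := hasDerivAt_dotProduct ((hb s).fun_sub (ha s)) ((hc s).fun_add (hd s))
    refine h.congr_deriv ?_
    have e1 : (C *ᵥ b s - φ s • x - (-(C *ᵥ a s) + φ s • x)) = C *ᵥ (a s + b s) - (2 * φ s) • x := by
      rw [Matrix.mulVec_add, mul_smul, two_smul]; abel
    have e2 : (-(C *ᵥ c s) + φ s • z + (C *ᵥ d s - φ s • z)) = C *ᵥ (d s - c s) := by
      rw [Matrix.mulVec_sub]; abel
    have key : (C *ᵥ (a s + b s)) ⬝ᵥ (c s + d s) = (a s + b s) ⬝ᵥ (Cᵀ *ᵥ (c s + d s)) := by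
      have := transpose_mulVec_dotProduct Cᵀ (a s + b s) (c s + d s)
      rwa [Matrix.transpose_transpose] at this
    rw [e1, e2, sub_dotProduct, key, smul_dotProduct, smul_eq_mul]
    ring
  have hI : Continuous fun s => ((a s + b s) ⬝ᵥ (Cᵀ *ᵥ (c s + d s)) + (b s - a s) ⬝ᵥ (C *ᵥ (d s - c s))) :=
    ((hac.add hbc).dotProduct (continuous_const.matrix_mulVec (hcc.add hdc))).add
      ((hbc.sub hac).dotProduct (continuous_const.matrix_mulVec (hdc.sub hcc)))
  have hS : Continuous fun s => 2 * (φ s * (x ⬝ᵥ (c s + d s))) :=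
    continuous_const.mul (hφ.mul (continuous_const.dotProduct (hcc.add hdc)))
  have hiI : IntervalIntegrable (fun s => ((a s + b s) ⬝ᵥ (Cᵀ *ᵥ (c s + d s)) + (b s - a s) ⬝ᵥ (C *ᵥ (d s - c s))))
      volume 0 1 := hI.intervalIntegrable _ _
  have hiS : IntervalIntegrable (fun s => 2 * (φ s * (x ⬝ᵥ (c s + d s)))) volume 0 1 := hS.intervalIntegrable _ _
  have hftc := intervalIntegral.integral_eq_sub_of_hasDerivAt (fun s _ => hΨ s) (hiI.sub hiS)
  rw [intervalIntegral.integral_sub hiI hiS, intervalIntegral.integral_const_mul] at hftc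
  simp only [hb1, ha0, hc0, hd1, zero_sub, sub_zero, add_zero, zero_add, neg_dotProduct] at hftc
  linarith

end GreenAbstract

end Summit.AnomalousDissipation.AnomalousDissipation.Theorems.SolenoidalFractalHomogenisation.LagrangianStep.OddGain

end
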